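import Summits.ValiantsHypothesis.ValiantsHypothesis.Theorems.BarrierLeverHubWordCertificates

/-!
# Route BarrierLever — word certificates WITHOUT a hub-uniqueness check (TT, item 19152 / residual 19930)

Companion of `…Theorems.BarrierLeverHubWordCertificates` (p489127; `--supports stmt-ValiantsHypothesis-19930`;
cell valiant-natproofs, rung V4, prover gen 9; memo `HOME/prover/gen9/HUB-MEMO-g9.md` §3). It does NOT import
the route file.

**Observation** (planner p1-g13, RESULT-hubcensus-h5 «structural remark»; module form in the memo): a
compression word `S →* F` gives `ALIVE(X, F) ⟹ ALIVE(X, S)` for EVERY row family `X` (in module terms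
`M_F ⊆ M_S`), and CONTAINMENT is transitive for free. Hence if the two sides `S`, `T` of a layout reach, by
checked words, relabelings `σ₁ ∘ H`, `σ₂ ∘ H` of ONE family `H` (strictly increasing rows, injective —
nothing else), then `(S, T)` is alive:
`ALIVE(σ₂H, σ₁H)` (a permutation matrix) ⟹ `ALIVE(σ₂H, K_S)` (the end of `S`'s word is a rearrangement of
`σ₁H`) ⟹ `ALIVE(σ₂H, S)` (un-compress) ⟹ `ALIVE(S, σ₂H)` (transpose) ⟹ `ALIVE(S, K_T)` ⟹ `ALIVE(S, T)`.
No threshold weight `ψ`, no uniqueness hypothesis, no hub lemma: `tt_of_wordCerts`. (The hub lemma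
`Hub.alive_trans_of_hub` remains what joins two sides that are merely ALIVE against a UDS hub, e.g. by a
zig-zag of words; for straight two-word certificates it is not needed, and the expensive `decide` of the
threshold property over all `d`-tuples disappears — certificates at `h = 5..8` become practical.)

WHAT THIS IS NOT: soundness of a certificate format; no words are found here; nothing on item 19930 in
general, on TT / TNS / 19717, on crux stmt-ValiantsHypothesis-14610, or on `VP` versus `VNP`.
-/

-- layout Summits/ValiantsHypothesis/ValiantsHypothesis forces the duplicated namespace component
set_option linter.dupNamespace false

namespace Summit.ValiantsHypothesis.ValiantsHypothesis.Theorems.BarrierLever.HubCert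

open Matrix Hub

variable {r d n nr : ℕ}

/-- Rearranging the columns of a configuration (outer permutation `π`, slot permutations `τ j`) keeps it
alive against any rows `R` (same witness; the layout matrix is column-permuted and column-scaled by signs). -/
theorem alive_cols_rearranged (R : Fin r → Fin d → Fin nr) (C : Fin r → Fin d → Fin n)
    (π : Equiv.Perm (Fin r)) (τ : Fin r → Equiv.Perm (Fin d))
    (h : ∃ G : Matrix (Fin nr) (Fin n) ℂ,
      (Matrix.of fun i j : Fin r => (G.submatrix (R i) (C j)).det).det ≠ 0) :
    ∃ G : Matrix (Fin nr) (Fin n) ℂ,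
      (Matrix.of fun i j : Fin r => (G.submatrix (R i) (C (π j) ∘ τ j)).det).det ≠ 0 := by
  obtain ⟨G, hG⟩ := h
  refine ⟨G, ?_⟩
  set M : Matrix (Fin r) (Fin r) ℂ := Matrix.of fun i j : Fin r => (G.submatrix (R i) (C j)).det
    with hM
  have hE : (Matrix.of fun i j : Fin r => (G.submatrix (R i) (C (π j) ∘ τ j)).det) =
      Matrix.of fun i j : Fin r =>
        (((Equiv.Perm.sign (τ j) : ℤˣ) : ℤ) : ℂ) * (M.submatrix id π) i j := by
    ext i j
    rw [Matrix.of_apply, Matrix.of_apply, Compression.det_submatrix_comp_perm, Matrix.submatrix_apply,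
      hM, Matrix.of_apply]
    rfl
  rw [hE, Matrix.det_mul_row, Matrix.det_permute']
  have hu : ∀ u : ℤˣ, ((u : ℤ) : ℂ) ≠ 0 := fun u => by
    rcases Int.units_eq_one_or u with h | h <;> simp [h]
  refine mul_ne_zero (Finset.prod_ne_zero_iff.mpr fun j _ => hu _) (mul_ne_zero (hu _) ?_)
  rw [hM]
  exact hG

/-- **Columns that cover a relabeled hub are a rearrangement of it**, for ANY rows `R`: if every member of
`σ ∘ H` (hub `H` with strictly increasing rows, injective) is covered by a column of `K` (injective
columns) and `(R, σ ∘ H)` is alive, then `(R, K)` is alive (`alive_cols_rearranged`). -/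
theorem alive_cols_of_cover (R : Fin r → Fin d → Fin nr) (H K : Fin r → Fin d → Fin n)
    (σ : Equiv.Perm (Fin n)) (hm : ∀ j, StrictMono (H j)) (hi : Function.Injective H)
    (hK : ∀ j, Function.Injective (K j)) (h : ∀ j', ∃ j, ∀ q, ∃ q', σ (H j' q) = K j q')
    (hR : ∃ G : Matrix (Fin nr) (Fin n) ℂ,
      (Matrix.of fun i j : Fin r => (G.submatrix (R i) (fun c => σ (H j c))).det).det ≠ 0) :
    ∃ G : Matrix (Fin nr) (Fin n) ℂ,
      (Matrix.of fun i j : Fin r => (G.submatrix (R i) (K j)).det).det ≠ 0 := by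
  classical
  choose s hs using h
  have hσH : ∀ j', Function.Injective (fun q => σ (H j' q)) :=
    fun j' q₁ q₂ hq => (hm j').injective (σ.injective hq)
  have hrange : ∀ j', Finset.univ.image (fun q => σ (H j' q)) = Finset.univ.image (K (s j')) := by
    intro j'
    apply Finset.eq_of_subset_of_card_le
    · intro a ha
      obtain ⟨q, -, rfl⟩ := Finset.mem_image.mp ha
      obtain ⟨q', hq'⟩ := hs j' q
      exact Finset.mem_image.mpr ⟨q', Finset.mem_univ _, hq'.symm⟩
    · simp only [Finset.card_image_of_injective _ (hK _), Finset.card_image_of_injective _ (hσH j'),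
        le_refl]
  -- s is injective (the relabeled hub has pairwise distinct member sets), hence a permutation
  have hsi : Function.Injective s := by
    intro j₁ j₂ hj
    apply hi
    have hc : (Finset.univ.image (H j₂)).card = d := by
      rw [Finset.card_image_of_injective _ (hm j₂).injective, Finset.card_univ, Fintype.card_fin]
    have hmem : ∀ q, H j₁ q ∈ Finset.univ.image (H j₂) := by
      intro q
      have h1 : σ (H j₁ q) ∈ Finset.univ.image (K (s j₂)) := by
        rw [← hj, ← hrange j₁]
        exact Finset.mem_image_of_mem _ (Finset.mem_univ q)
      rw [← hrange j₂] at h1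
      obtain ⟨q', -, hq'⟩ := Finset.mem_image.mp h1
      exact Finset.mem_image.mpr ⟨q', Finset.mem_univ _, σ.injective hq'⟩
    have e1 := Finset.orderEmbOfFin_unique hc (f := H j₁) hmem (hm j₁)
    have e2 := Finset.orderEmbOfFin_unique hc (f := H j₂)
      (fun q => Finset.mem_image_of_mem _ (Finset.mem_univ q)) (hm j₂)
    exact e1.trans e2.symm
  set π : Equiv.Perm (Fin r) := Equiv.ofBijective s (Finite.injective_iff_bijective.mp hsi)
    with hπ_def
  -- each K (s j') is a slot permutation of σ ∘ H j'
  have hcov : ∀ j' q', ∃ q, K (s j') q' = σ (H j' q) := by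
    intro j' q'
    have hmem : K (s j') q' ∈ Finset.univ.image (fun q => σ (H j' q)) := by
      rw [hrange j']
      exact Finset.mem_image_of_mem _ (Finset.mem_univ q')
    obtain ⟨q, -, hq⟩ := Finset.mem_image.mp hmem
    exact ⟨q, hq.symm⟩
  have hτ0 : ∀ j', ∃ τ : Equiv.Perm (Fin d), K (s j') = (fun q => σ (H j' q)) ∘ τ :=
    fun j' => exists_perm_of_covers _ _ (hK (s j')) (hcov j')
  choose τ hτ using hτ0
  -- reindex: columns j ↦ π⁻¹-preimage, slots by τ
  -- K = (σH ∘ π⁻¹-reindexed) with slot permutations: K j = σH (π⁻¹ j) ∘ τ (π⁻¹ j)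
  have hK' : ∀ j, K j = (fun c => σ (H (π.symm j) c)) ∘ τ (π.symm j) := by
    intro j
    have h1 : K (s (π.symm j)) = (fun q => σ (H (π.symm j) q)) ∘ τ (π.symm j) := hτ (π.symm j)
    have h2 : s (π.symm j) = j := by
      rw [hπ_def]
      exact Equiv.ofBijective_apply_symm_apply s _ j
    rw [h2] at h1
    exact h1
  have hfin := alive_cols_rearranged R (fun j c => σ (H j c)) π.symm (fun j => τ (π.symm j)) hR
  obtain ⟨G, hG⟩ := hfin
  refine ⟨G, ?_⟩
  have hMx : (Matrix.of fun i j : Fin r => (G.submatrix (R i) (K j)).det) =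
      Matrix.of fun i j : Fin r =>
        (G.submatrix (R i) ((fun c => σ (H (π.symm j) c)) ∘ τ (π.symm j))).det := by
    ext i j
    rw [Matrix.of_apply, Matrix.of_apply, hK' j]
  rw [hMx]
  exact hG

/-- **Two checked words to relabelings of one family ⟹ the layout is alive — no threshold check.**
`H`: any family with strictly increasing rows and pairwise distinct members (NOT assumed UDS/threshold);
`S, T`: the two sides (injective columns); words from `S` and `T` whose end configurations cover
`σ₁ ∘ H` and `σ₂ ∘ H`. Chain: `ALIVE(H,H)` (identity matrix) ⟹ `ALIVE(σ₂H, σ₁H)` (relabel) ⟹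
`ALIVE(σ₂H, K_S)` ⟹ `ALIVE(σ₂H, S)` ⟹ `ALIVE(S, σ₂H)` ⟹ `ALIVE(S, K_T)` ⟹ `ALIVE(S, T)`. -/
theorem tt_of_wordCerts (H : Fin r → Fin d → Fin n) (hm : ∀ j, StrictMono (H j))
    (hi : Function.Injective H) (S T : Fin r → Fin d → Fin n)
    (hS : ∀ j, Function.Injective (S j)) (hT : ∀ j, Function.Injective (T j))
    (σ₁ σ₂ : Equiv.Perm (Fin n)) (wS wT : List (Fin n × Fin n × (Fin r → Fin d → Fin n)))
    (hwS : stepsOK S wS = true) (heS : ∀ j', ∃ j, ∀ q, ∃ q', σ₁ (H j' q) = lastCfg S wS j q')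
    (hwT : stepsOK T wT = true) (heT : ∀ j', ∃ j, ∀ q, ∃ q', σ₂ (H j' q) = lastCfg T wT j q') :
    ∃ G : Matrix (Fin n) (Fin n) ℂ,
      (Matrix.of fun i j : Fin r => (G.submatrix (S i) (T j)).det).det ≠ 0 := by
  have h0 := alive_of_rearrangement H H hm hi 1 (fun _ => 1) (fun j => by simp)
  have h1 := alive_relabel H H σ₂ σ₁ h0
  have h2 := alive_cols_of_cover (fun i a => σ₂ (H i a)) H (lastCfg S wS) σ₁ hm hi
    (lastCfg_injective wS S hS hwS) heS h1
  have h3 := alive_of_stepsOK (fun i a => σ₂ (H i a)) wS S hS hwS h2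
  have h4 := alive_symm (ι := Fin r) _ _ h3
  have h5 := alive_cols_of_cover S H (lastCfg T wT) σ₂ hm hi (lastCfg_injective wT T hT hwT) heT h4
  exact alive_of_stepsOK S wT T hT hwT h5

end Summit.ValiantsHypothesis.ValiantsHypothesis.Theorems.BarrierLever.HubCert
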